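import Mathlib.NumberTheory.Zsqrtd.Basic
import Mathlib.Tactic.LinearCombination
import Mathlib.Tactic.Ring
import Mathlib.Tactic.NormNum
import Mathlib.Tactic.Linarith
import HarnessLib

/-!
# NSC(−2) · THE EULER LEDGER of the 27-TEST (prover 2 gen 33; carver C823 (b) (H6), C819 (b) LEMMA OB), as pure algebra

Family `hodge`, b2b cell `hweil`, NSC programme (packet `run/shared/lean/b2b/hodge-weil/LADDER.md ## CARVER v136` C823 (b) THE HABITAT DOOR «H-27»,
(H5) the 27-TEST, (H6) EULER LEDGER). Helper of item stmt-HodgeConjecture-2524 — the bookkeeping every lane now uses when it tests a candidate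
threefold `Z ⊂ X` (lci of codimension 3 in an abelian sixfold, `[Z] = q·h³ + w`, `w ≠ 0` a Weil class) for Bloch-semiregularity
(`h¹(N_Z) = 27` ⟺ semiregular, C819 (b)). Mathlib + `HarnessLib` only; def-free; 0 sorry. C803 (d)(iii)'s «compute π for degeneracy loci» in
the form the cell lead's v136 gives it: the Euler-characteristic side of `π : H¹(Z, N_Z) → H⁴(X, Ω²_X)`.

THE LEDGER (C823 (H6), pen-and-paper there): with `T_X|_Z` trivial, `0 → T_Z → 𝒪_Z^6 → N → 0` gives `c(N) = c(T_Z)⁻¹`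
(`nsc_euler_normal_chern`: `n₁ = −c₁`, `n₂ = c₁² − c₂`, `n₃ = −c₁³ + 2c₁c₂ − c₃`); Hirzebruch–Riemann–Roch on the threefold `Z` then collapses to
**`χ(N_{Z/X}) = χ(𝒪_Z) + ½∫_Z c₃(N) = χ(𝒪_Z) + ½(Z·Z)_X`** (`nsc_euler_chi_normal`: `144·[ch(N)·td(T_Z)]₃ = 6c₁c₂ + 72n₃`, i.e. `χ(𝒪_Z) = ∫c₁c₂/24`
plus `½∫n₃`) **`= 6χ(𝒪_Z) − χ(T_Z)`** (`nsc_euler_six_chiO_sub_chiT`), and `(Z·Z)_X = ∫_X [Z]² = q²·∫h⁶ + w·w` because `h·w = 0`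
(`nsc_euler_self_intersection`), with `w·w < 0` by Hodge–Riemann for the primitive real `(3,3)`-class `w` (the sign is NOT proved here; the
weight mismatch that makes `h ∪ W = 0` on the generic habitat member — `x = √−3` scales `W` by `x⁶ = −27` but `h⁴` by `N(x)³ = 27` — is
`nsc_euler_weight_mismatch`). First budget line of the 27-TEST (`nsc_euler_budget`): `h²(N) − h³(N) = χ(N) − h⁰(N) + h¹(N)`, `h⁰(N) ≥ 6`
(translations), `h¹(N) ≥ 27` for `w ≠ 0` (LEMMA OB, seat level).

HONEST FRAMING: integer polynomial identities (`ring` / `linear_combination` / `decide`); the geometric dictionary (normal bundle sequence, HRR,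
Hodge–Riemann, LEMMA OB) is the packet's pen-and-paper and is NOT asserted. Nothing here is a rung, a case of the Hodge conjecture, or evidence
for NSC(−2); no statement of [Markman 2025] / [Perry 2026] is used. [cite: Fulton1998, §3.2 (Whitney) and §15.2 (HRR)] [cite: Bloch1972Semiregularity, §6]
-/

-- mandated namespace `Summit.HodgeConjecture.HodgeConjecture.…` (Problem = Summit) trips `linter.dupNamespace`; the lakefile disables it
-- tree-wide (weak option), restated here so stand-alone elaboration is warning-free too.
set_option linter.dupNamespace false

namespace Summit.HodgeConjecture.HodgeConjecture.WeilTypeLadder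

section NscEulerLedger

/-- **`c(N_{Z/X}) = c(T_Z)⁻¹` for `T_X|_Z` trivial** (Whitney for `0 → T_Z → 𝒪⁶ → N → 0` on a threefold): the classes
`n₁ = −c₁`, `n₂ = c₁² − c₂`, `n₃ = −c₁³ + 2c₁c₂ − c₃` make the degree-1, -2, -3 parts of `c(T_Z)·c(N)` vanish. [cite: Fulton1998, §3.2 Thm. 3.2 (e)] -/
theorem nsc_euler_normal_chern {R : Type*} [CommRing R] (c₁ c₂ c₃ n₁ n₂ n₃ : R) (h₁ : n₁ = -c₁) (h₂ : n₂ = c₁ ^ 2 - c₂)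
    (h₃ : n₃ = -c₁ ^ 3 + 2 * c₁ * c₂ - c₃) :
    c₁ + n₁ = 0 ∧ c₂ + c₁ * n₁ + n₂ = 0 ∧ c₃ + c₂ * n₁ + c₁ * n₂ + n₃ = 0 := by
  subst h₁ h₂ h₃
  exact ⟨by ring, by ring, by ring⟩

/-- **`χ(N_{Z/X}) = χ(𝒪_Z) + ½∫_Z c₃(N)`** (C823 (H6)), as the degree-3 identity of Hirzebruch–Riemann–Roch on the threefold `Z` with denominators
cleared: `6·ch(N) = 18 + 6n₁ + 3(n₁² − 2n₂) + (n₁³ − 3n₁n₂ + 3n₃)`, `24·td(T_Z) = 24 + 12c₁ + 2(c₁² + c₂) + c₁c₂`, and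
`144·[ch(N)·td(T_Z)]₃ = 24(n₁³ − 3n₁n₂ + 3n₃) + 3(n₁² − 2n₂)·12c₁ + 6n₁·2(c₁² + c₂) + 18·c₁c₂ = 6·c₁c₂ + 72·n₃` for `c(N) = c(T_Z)⁻¹` — divide by
`144`: `χ(N) = ∫c₁c₂/24 + ½∫n₃ = χ(𝒪_Z) + ½(Z·Z)_X`. [cite: Fulton1998, §15.2 Cor. 15.2.1 (HRR)] -/
theorem nsc_euler_chi_normal {R : Type*} [CommRing R] (c₁ c₂ c₃ n₁ n₂ n₃ : R) (h₁ : n₁ = -c₁) (h₂ : n₂ = c₁ ^ 2 - c₂)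
    (h₃ : n₃ = -c₁ ^ 3 + 2 * c₁ * c₂ - c₃) :
    24 * (n₁ ^ 3 - 3 * n₁ * n₂ + 3 * n₃) + 3 * (n₁ ^ 2 - 2 * n₂) * (12 * c₁) + 6 * n₁ * (2 * (c₁ ^ 2 + c₂)) + 18 * (c₁ * c₂)
      = 6 * (c₁ * c₂) + 72 * n₃ := by
  subst h₁ h₂ h₃
  ring

/-- **`χ(N_{Z/X}) = 6χ(𝒪_Z) − χ(T_Z)`** (the additive form of the ledger, from `0 → T_Z → 𝒪_Z⁶ → N → 0`), again ×144:
`144·6·(c₁c₂/24) − 144·[ch(T_Z)·td(T_Z)]₃ = 6c₁c₂ + 72n₃` with `n₃ = −c₁³ + 2c₁c₂ − c₃`. [cite: Fulton1998, §15.2 Cor. 15.2.1 (HRR)] -/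
theorem nsc_euler_six_chiO_sub_chiT {R : Type*} [CommRing R] (c₁ c₂ c₃ : R) :
    36 * (c₁ * c₂) - (24 * (c₁ ^ 3 - 3 * c₁ * c₂ + 3 * c₃) + 3 * (c₁ ^ 2 - 2 * c₂) * (12 * c₁) + 6 * c₁ * (2 * (c₁ ^ 2 + c₂))
      + 18 * (c₁ * c₂)) = 6 * (c₁ * c₂) + 72 * (-c₁ ^ 3 + 2 * c₁ * c₂ - c₃) := by
  ring

/-- **`(Z·Z)_X = q²·h⁶ + w²`**: for a seed class `[Z] = q·h³ + w` with `h·w = 0` (the Weil plane is cup-orthogonal to every `K`-symmetric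
class, `WeilClassesPolarizationOrthogonal`), `[Z]² = q²h⁶ + w²` — the mixed term dies. With `w² = w·w < 0` (Hodge–Riemann, not proved here)
this is C823 (H6)'s `q²·∫h⁶ − |w·w|`. [cite: vanGeemen1994HodgeAV, proof of Lemma 5.2 (6)] -/
theorem nsc_euler_self_intersection {R : Type*} [CommRing R] (q h w : R) (hw : h * w = 0) :
    (q * h ^ 3 + w) ^ 2 = q ^ 2 * h ^ 6 + w ^ 2 := by
  linear_combination (2 * q * h ^ 2) * hw

/-- **The weight mismatch behind `h ∪ W = 0` on the generic habitat member** (C823 (H6)): in `ℤ[√−3]`, `x = √−3` has `x⁶ = −27` while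
`N(x)³ = (x·x̄)³ = 27` — so a class scaled by `x⁶` (the Weil line, `∧⁶_K`) cannot equal a non-zero class scaled by `N(x)³` (`h³`-multiples),
and `h ∪ w ∈ (H⁸)^{Hg} = ℚh⁴` forces `h ∪ w = 0`. [`decide` in `ℤ√(−3)`] -/
theorem nsc_euler_weight_mismatch :
    (Zsqrtd.sqrtd : ℤ√(-3)) ^ 6 = -27 ∧ ((Zsqrtd.sqrtd : ℤ√(-3)) * star Zsqrtd.sqrtd) ^ 3 = 27 ∧ (-27 : ℤ√(-3)) ≠ 27 := by
  refine ⟨by decide, by decide, by decide⟩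

/-- **The first budget line of the 27-TEST** (C823 (H6)): from `χ(N) = h⁰ − h¹ + h² − h³`, `h²(N) − h³(N) = χ(N) − h⁰(N) + h¹(N)`, and
with `h¹(N) ≥ 27` (LEMMA OB for `w ≠ 0`, seat level) `h⁰(N) + h²(N) − h³(N) ≥ χ(N) + 27` — the obstruction side `h²(N)` is bounded below by the
Euler ledger once `h⁰` (translations, `≥ 6`) and `h³` are known. [folklore] -/
theorem nsc_euler_budget (χ h0 h1 h2 h3 : ℤ) (hχ : χ = h0 - h1 + h2 - h3) (hh1 : 27 ≤ h1) :
    h2 - h3 = χ - h0 + h1 ∧ χ + 27 ≤ h0 + h2 - h3 := by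
  subst hχ
  constructor
  · ring
  · linarith

end NscEulerLedger

end Summit.HodgeConjecture.HodgeConjecture.WeilTypeLadder
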